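import Summits.ABC.ABC.Theorems.TowerFourSubLiouville.Negative.TwoExponentDiagram

/-!
# `TowerFourSubLiouville` (stmt-ABC-1649): the degenerate column `θ = 0` of the two-exponent diagram

Negative-side note of the standing disprover (cycle 11, refuter-cdisprove-stmt-ABC-1649-g11-0, 2026-08-17), companion of
`Negative.TwoExponentDiagram` (p126869) and `Negative.TwoExponentSandwich` (this cycle).

In the two-exponent matrix `UBQ₂(θ, φ)` (`max(v,w) ≤ Z^θ ⟹ |wZ⁴ − vY⁴| > Z^φ` for coprime `vY, wZ`, `Z ≥ Z₀`) the
coefficient budget at `θ = 0` is `max(v,w) ≤ Z⁰ = 1`: the single form `Z⁴ − Y⁴`, whose values at `Y ≠ Z` are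
`≥ Z⁴ − (Z−1)⁴ > Z³` (`Z ≥ 2`) and equal `4Z³ − 6Z² + 4Z − 1 < Z^φ` (`φ > 3`, `Z` large) at `Y = Z − 1`.  Hence

* `ubq₂_theta_zero_of_le_three`: `UBQ₂(0, φ)` holds for every `φ ≤ 3` (threshold `Z₀ = 2`);
* `not_ubq₂_theta_zero_of_three_lt`: `UBQ₂(0, φ)` fails for every `φ > 3`.

So the `θ = 0` column is pinned at `φ = 3` (Liouville's exponent for the one remaining form), NOT at `2`: the landed
Dirichlet corner `(0, 2)` (`not_ubq₂_corner_zero_two`, forms `(1,2)`, `(8,1)` of height `8 ≤ Z^θ`) is a limit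
`θ → 0⁺`, the proved FALSE region `{θ > 0, φ > 2}` is not closed at its corner, and the per-form Roth box
(`stub_fixedFormsRoth`, any FIXED height `H`, every `φ < 2`) is a different statement from the `θ = 0` slice of this
matrix — a degenerate-instance remark for anyone quantifying over `θ ≥ 0` (e.g. `ubq₂_of_abc` allows `θ = 0`, where it
asserts only `φ < 2 < 3`).
-/

-- `Summit.ABC.ABC` is the mandated summit-side namespace (CONVENTIONS §2); the duplicate is deliberate.
set_option linter.dupNamespace false

namespace Summit.ABC.ABC.Theorems.TowerFourSubLiouville.Negative

/-- `UBQ₂(0, φ)` holds for every `φ ≤ 3` (threshold `Z₀ = 2`). -/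
theorem ubq₂_theta_zero_of_le_three {φ : ℝ} (hφ : φ ≤ 3) :
    ∃ Z₀ : ℕ, ∀ v w Y Z : ℕ, Z₀ ≤ Z → 0 < v → 0 < w → 0 < Y → Nat.Coprime (v * Y) (w * Z) →
      ((max v w : ℕ) : ℝ) ≤ (Z : ℝ) ^ (0:ℝ) → w * Z ^ 4 ≠ v * Y ^ 4 →
      (Z : ℝ) ^ φ < |((w * Z ^ 4 : ℕ) : ℝ) - ((v * Y ^ 4 : ℕ) : ℝ)| := by
  refine ⟨2, fun v w Y Z hZ hv hw _ _ hmax hne => ?_⟩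
  rw [Real.rpow_zero] at hmax
  have hv1 : v = 1 := by
    have : (v : ℝ) ≤ 1 := le_trans (by exact_mod_cast le_max_left v w) hmax
    have : v ≤ 1 := by exact_mod_cast this
    omega
  have hw1 : w = 1 := by
    have : (w : ℝ) ≤ 1 := le_trans (by exact_mod_cast le_max_right v w) hmax
    have : w ≤ 1 := by exact_mod_cast this
    omega
  subst hv1; subst hw1
  simp only [one_mul] at hne ⊢
  have hZR : (2:ℝ) ≤ (Z:ℝ) := by exact_mod_cast hZ
  have hZ1 : (1:ℝ) ≤ (Z:ℝ) := by linarith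
  -- Z^φ ≤ Z^3 < |Z⁴ − Y⁴|
  have hφ3 : (Z:ℝ) ^ φ ≤ (Z:ℝ) ^ (3:ℕ) := by
    rw [← Real.rpow_natCast]
    exact Real.rpow_le_rpow_of_exponent_le hZ1 (by exact_mod_cast hφ)
  refine lt_of_le_of_lt hφ3 ?_
  push_cast
  rcases lt_or_gt_of_ne (fun h : Z = Y => hne (by rw [h])) with hlt | hgt
  · -- Z < Y: Y⁴ − Z⁴ ≥ (Z+1)⁴ − Z⁴ > Z³
    have hY : (Z:ℝ) + 1 ≤ (Y:ℝ) := by exact_mod_cast hlt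
    have h4 : ((Z:ℝ) + 1) ^ 4 ≤ (Y:ℝ) ^ 4 := pow_le_pow_left₀ (by linarith) hY 4
    have e : ((Z:ℝ) + 1) ^ 4 = (Z:ℝ) ^ 4 + 4 * (Z:ℝ) ^ 3 + 6 * (Z:ℝ) ^ 2 + 4 * (Z:ℝ) + 1 := by ring
    have h2 : (0:ℝ) ≤ (Z:ℝ) ^ 2 := by positivity
    have h3 : (0:ℝ) ≤ (Z:ℝ) ^ 3 := by positivity
    rw [abs_sub_comm, abs_of_nonneg (by linarith)]
    linarith
  · -- Y < Z: Z⁴ − Y⁴ ≥ Z⁴ − (Z−1)⁴ = 4Z³ − 6Z² + 4Z − 1 > Z³ for Z ≥ 2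
    have hY : (Y:ℝ) ≤ (Z:ℝ) - 1 := by
      have : Y + 1 ≤ Z := hgt
      have : ((Y + 1 : ℕ) : ℝ) ≤ (Z:ℝ) := by exact_mod_cast this
      push_cast at this; linarith
    have hY0 : (0:ℝ) ≤ (Y:ℝ) := by positivity
    have h4 : (Y:ℝ) ^ 4 ≤ ((Z:ℝ) - 1) ^ 4 := pow_le_pow_left₀ hY0 hY 4
    have e : ((Z:ℝ) - 1) ^ 4 = (Z:ℝ) ^ 4 - 4 * (Z:ℝ) ^ 3 + 6 * (Z:ℝ) ^ 2 - 4 * (Z:ℝ) + 1 := by ring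
    have h1 : (0:ℝ) ≤ (Z:ℝ) ^ 2 * ((Z:ℝ) - 2) := mul_nonneg (by positivity) (by linarith)
    have e1 : (Z:ℝ) ^ 2 * ((Z:ℝ) - 2) = (Z:ℝ) ^ 3 - 2 * (Z:ℝ) ^ 2 := by ring
    have h2 : (0:ℝ) ≤ (Z:ℝ) ^ 2 := by positivity
    rw [abs_of_nonneg (by linarith)]
    linarith

/-- `UBQ₂(0, φ)` FAILS for every `φ > 3` (witness `Y = Z − 1`, value `4Z³ − 6Z² + 4Z − 1`). -/
theorem not_ubq₂_theta_zero_of_three_lt {φ : ℝ} (hφ : 3 < φ) :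
    ¬ ∃ Z₀ : ℕ, ∀ v w Y Z : ℕ, Z₀ ≤ Z → 0 < v → 0 < w → 0 < Y → Nat.Coprime (v * Y) (w * Z) →
      ((max v w : ℕ) : ℝ) ≤ (Z : ℝ) ^ (0:ℝ) → w * Z ^ 4 ≠ v * Y ^ 4 →
      (Z : ℝ) ^ φ < |((w * Z ^ 4 : ℕ) : ℝ) - ((v * Y ^ 4 : ℕ) : ℝ)| := by
  rintro ⟨Z₀, h⟩
  obtain ⟨N, hN⟩ := eventually_const_mul_rpow_le 4 3 φ hφ
  -- take Z = max (max Z₀ N) 2, Y = Z - 1, v = w = 1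
  set Z : ℕ := max (max Z₀ N) 2 with hZdef
  have hZ2 : 2 ≤ Z := le_max_right _ _
  have hZ₀ : Z₀ ≤ Z := le_trans (le_max_left _ _) (le_max_left _ _)
  have hZN : N ≤ Z := le_trans (le_max_right _ _) (le_max_left _ _)
  have hcop : Nat.Coprime (1 * (Z - 1)) (1 * Z) := by
    simp only [one_mul]
    have : Z = (Z - 1) + 1 := by omega
    rw [Nat.coprime_comm, this, Nat.add_sub_cancel]
    exact Nat.coprime_self_add_left.mpr (Nat.coprime_one_left _)
  have hmax : ((max 1 1 : ℕ) : ℝ) ≤ (Z : ℝ) ^ (0:ℝ) := by rw [Real.rpow_zero]; norm_num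
  have hne : 1 * Z ^ 4 ≠ 1 * (Z - 1) ^ 4 := by
    simp only [one_mul]
    intro h
    have := Nat.pow_left_injective (by norm_num : 4 ≠ 0) h
    omega
  have key := h 1 1 (Z - 1) Z hZ₀ one_pos one_pos (by omega) hcop hmax hne
  have h4 := hN Z hZN
  -- value: Z⁴ − (Z−1)⁴ = 4Z³ − 6Z² + 4Z − 1 ≤ 4 Z³
  have hZR : (2:ℝ) ≤ (Z:ℝ) := by exact_mod_cast hZ2
  have hval : |((1 * Z ^ 4 : ℕ) : ℝ) - ((1 * (Z - 1) ^ 4 : ℕ) : ℝ)| ≤ 4 * (Z:ℝ) ^ (3:ℝ) := by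
    have hsub : (((Z - 1 : ℕ) : ℝ)) = (Z:ℝ) - 1 := by
      rw [Nat.cast_sub (by omega)]; norm_num
    push_cast
    rw [hsub, show ((Z:ℝ) ^ (3:ℝ)) = (Z:ℝ) ^ (3:ℕ) by rw [← Real.rpow_natCast]; norm_num]
    have e : (1:ℝ) * (Z:ℝ) ^ 4 - 1 * ((Z:ℝ) - 1) ^ 4 = 4 * (Z:ℝ) ^ 3 - 6 * (Z:ℝ) ^ 2 + 4 * (Z:ℝ) - 1 := by ring
    have h1 : (0:ℝ) ≤ (Z:ℝ) ^ 2 * (4 * (Z:ℝ) - 6) := mul_nonneg (by positivity) (by linarith)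
    have e1 : (Z:ℝ) ^ 2 * (4 * (Z:ℝ) - 6) = 4 * (Z:ℝ) ^ 3 - 6 * (Z:ℝ) ^ 2 := by ring
    have h2 : (0:ℝ) ≤ (Z:ℝ) * (6 * (Z:ℝ) - 4) := mul_nonneg (by positivity) (by linarith)
    have e2 : (Z:ℝ) * (6 * (Z:ℝ) - 4) = 6 * (Z:ℝ) ^ 2 - 4 * (Z:ℝ) := by ring
    rw [abs_of_nonneg (by linarith)]
    linarith
  linarith

end Summit.ABC.ABC.Theorems.TowerFourSubLiouville.Negative
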